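/-
Copyright (c) 2026. All rights reserved.
Released under Apache 2.0 license as described in the file LICENSE.
Authors: abc-iut cell, seat abc-iut-w5-d144 (gen 5; row «H1PRIME-ELLIPTIC-MULTI», part 2: «Aut(E ∖ S) →
Out(π̂₁)» injective and the unconditional id-rigidity of «objects of EA mapping to E ∖ S»).
-/
import Literature.AnabelianGeometry.AbsoluteAnabelian.ArchimedeanHolFieldFunctorGeometricTorusMinusFiniteTwist
import HarnessLib

/-!
# [AbsTopIII] Prop. 4.2 (i) at EVERY elliptic curve minus a non-empty finite set, unconditionally:
# «`Aut(E ∖ S) → Out(π̂₁)` is injective» and «objects of `EA` mapping to `E ∖ S`» is id-rigid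

S. Mochizuki, *Topics in Absolute Anabelian Geometry III*, Lemma 4.3 and the proof of Prop. 4.2 (i),
kurims p.106. [cite: MochizukiAbsTopIII2015, Proposition 4.2 (i) p.106]

PROOF-ONLY file (abc-iut cell, seat abc-iut-w5-d144 gen 5, row «H1PRIME-ELLIPTIC-MULTI»; campaign-L R1.2,
NODES AbsTopIII:Prop4.2(i)/Cor4.5 geometric column), part 2 of `…TorusMinusFiniteTwist`.  The per-object
residual (OUT) of `ArchimedeanHolFieldFunctorGeometricOuterRigid` — «an automorphism of `𝕏` acting on
`π̂₁(𝕏^top)` by an inner automorphism is trivial» — is DISCHARGED for the curves `𝕏 = E ∖ S` of type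
`(1, r)`, `r = |S| ≥ 1` (`E = ℂ/Φ(ℤ²)`, `HolRS.ofOpens ⟨Sᶜ, _⟩`), extending the gen-4 case `r = 1`
(`ArchimedeanHolFieldFunctorGeometricPuncturedTorusOuter`); hence «objects of `EA` mapping to `E ∖ S`»
is ID-RIGID with NO residual hypothesis (neither (H1), false here, nor the finiteness residuals
`hfin`/`hN` of the uniformisation route).

* ★ `HolRS.torusMinusFinite_outer` — **(OUT) at `E ∖ S`**;
* ★★ `HolRS.isIdRigid_mapsTo_complexTorus_compl_finite` — **«objects of `EA` mapping to `E ∖ S`» is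
  id-rigid, UNCONDITIONALLY, for every finite non-empty `S`** (type `(1, r)`, all `r ≥ 1`).

Classical mathematics; no definition, no instance, no Prop-valued fact; nothing here bears on
[IUTchIII] Cor. 3.12; model ≠ reconstruction; support library, not a node.

## References

* S. Mochizuki, *Topics in Absolute Anabelian Geometry III*, kurims ms, Lemma 4.3 / Prop. 4.2 (i)
  p.106. [MochizukiAbsTopIII2015]
* H. Lange, *Abelian Varieties over the Complex Numbers* (2023), §1.1.2 Prop. 1.1.6, §1.1.3 (1.3).
  [Lange2023AbelianVarietiesComplex]
* A. Hatcher, *Algebraic Topology* (2002), §1.1 Prop. 1.5, Prop. 1B.9. [HatcherAT2002]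
-/

set_option autoImplicit false

noncomputable section

open CategoryTheory Topology
open scoped Manifold ContDiff
open Literature.Topology.CoveringSpaces
open Literature.AlgebraicGeometry.Frobenioids (IsSlimGroup)
open Literature.IUT.HodgeTheaters (profiniteCompletion toCompletion)
open Literature.Geometry.Kaehler Literature.Geometry.Kaehler.ComplexTorus
open Literature.AlgebraicTopology.FundamentalGroup

namespace Literature.AnabelianGeometry.AbsoluteAnabelian

namespace HolRS

variable (Φ : (Fin 2 → ℝ) ≃L[ℝ] ℂ)

/-! ### §3 (OUT) for `E ∖ S` -/

section Outer

variable {S : Set (ComplexTorus Φ)}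

set_option maxHeartbeats 800000 in
/-- **(OUT) at an elliptic curve minus a non-empty finite set.**  For `𝕏 = E ∖ S` (`E = ℂ/Φ(ℤ²)`,
`S` finite non-empty), a base point `x′` carrying the two lattice loops inside `𝕏`, `σ ∈ Aut(𝕏)`,
`δ : x′ ⇝ σ x′` and an endomorphism `θ` of `π₁(𝕏^top, x′)` with `σ_* (θ γ) = δ⁻¹ · γ · δ`: if `θ` is
INNER on `π̂₁(𝕏^top, x′)` then `σ = 1` — `σ` extends to an affine `ρ(M) + c` preserving `S`; the
periods give `M = 1`; `c + S = S` gives `σ^d = 1`, `d = |S|`; `θ^d` is conjugation by the loop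
`δ · σδ ⋯ σ^{d-1}δ` (`twist_comp`), so `n^d ι(ℓ)` is central, hence `1`, in the free profinite
`π̂₁(E ∖ S)`; reading the lattice coordinates mod `d`, the lift `D(δ)` of `c` is a lattice vector,
`c = 0`.  This is [AbsTopIII] Lemma 4.3's input «`Aut(X) → Out(Π_X)` injective» at every curve of
type `(1, r)`. [cite: MochizukiAbsTopIII2015, Lemma 4.3 p.106]
[cite: Lange2023AbelianVarietiesComplex, §1.1.2 Prop. 1.1.6] -/
theorem torusMinusFinite_outer (hS : S.Finite) (hne : S.Nonempty)
    (x' : (ofOpens (M := ComplexTorus Φ) ⟨Sᶜ, hS.isClosed.isOpen_compl⟩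
      (isConnected_complexTorus_compl_finite Φ hS hne)).carrier)
    (hx' : ∀ i : Fin 2, ∃ γ : Path x' x',
      pathDisplacement Φ (γ.map continuous_subtype_val) = latticeVec Φ (Pi.single i 1))
    (σ : ofOpens (M := ComplexTorus Φ) ⟨Sᶜ, hS.isClosed.isOpen_compl⟩
        (isConnected_complexTorus_compl_finite Φ hS hne) ≅
      ofOpens (M := ComplexTorus Φ) ⟨Sᶜ, hS.isClosed.isOpen_compl⟩
        (isConnected_complexTorus_compl_finite Φ hS hne))
    (δ : Path x' (σ.hom.toFun x'))
    (θ : FundamentalGroup _ x' →* FundamentalGroup _ x')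
    (hθ : ∀ γ : FundamentalGroup _ x',
      Path.Homotopic.Quotient.map (FundamentalGroup.toPath (θ γ))
          ⟨σ.hom.toFun, σ.hom.mdifferentiable.continuous⟩ =
        (Path.Homotopic.Quotient.mk δ).symm.trans
          ((FundamentalGroup.toPath γ).trans (Path.Homotopic.Quotient.mk δ)))
    (hn : ∃ n : profiniteCompletion (FundamentalGroup _ x'),
      ∀ γ, toCompletion _ (θ γ) = n⁻¹ * toCompletion _ γ * n) :
    σ.hom = 𝟙 _ := by
  classical
  obtain ⟨n, hn⟩ := hn
  rcases id hne with ⟨s₀, hs₀⟩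
  obtain ⟨H, hHc, hHd, hHσ, hHS, hHaff⟩ := exists_affine_extension_of_iso_compl_finite Φ hS
    (isConnected_complexTorus_compl_finite Φ hS hne) σ
  let incl : C((ofOpens (M := ComplexTorus Φ) ⟨Sᶜ, hS.isClosed.isOpen_compl⟩
      (isConnected_complexTorus_compl_finite Φ hS hne)).carrier, ComplexTorus Φ) :=
    ⟨Subtype.val, continuous_subtype_val⟩
  let σ' : C((ofOpens (M := ComplexTorus Φ) ⟨Sᶜ, hS.isClosed.isOpen_compl⟩
      (isConnected_complexTorus_compl_finite Φ hS hne)).carrier, _) :=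
    ⟨σ.hom.toFun, σ.hom.mdifferentiable.continuous⟩
  let Hc : C(ComplexTorus Φ, ComplexTorus Φ) := ⟨H, hHc⟩
  let DX : FundamentalGroup _ x' → ℂ := fun γ =>
    classDisplacement Φ (Path.Homotopic.Quotient.map (FundamentalGroup.toPath γ) incl)
  let cc : FundamentalGroup _ x' →* Multiplicative (Fin 2 → ℤ) :=
    (AddMonoidHom.toMultiplicativeRight (periodCoords Φ x'.val)).comp (FundamentalGroup.map incl x')
  have key : ∀ γ', DX γ' = latticeVec Φ (Multiplicative.toAdd (cc γ')) := fun γ' => by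
    change classDisplacement Φ _ = latticeVec Φ (periodCoords Φ x'.val
      (Additive.ofMul (FundamentalGroup.map incl x' γ')))
    rw [latticeVec_periodCoords, periodHom_apply]
    rfl
  have hA : ∀ γ, DX (θ γ) = DX γ := by
    intro γ
    have hsep : ∀ a : Multiplicative (Fin 2 → ℤ), a ≠ 1 →
        ∃ (B : Type) (_ : CommGroup B) (_ : Finite B) (ψ : Multiplicative (Fin 2 → ℤ) →* B),
          ψ a ≠ 1 := by
      intro a ha
      have hv : Multiplicative.toAdd a ≠ 0 := fun h => ha (by
        rw [← ofAdd_toAdd a, h]; rfl)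
      obtain ⟨i, hi⟩ : ∃ i, Multiplicative.toAdd a i ≠ 0 := Function.ne_iff.mp hv
      let N : ℕ := (Multiplicative.toAdd a i).natAbs + 1
      haveI : NeZero N := ⟨Nat.succ_ne_zero _⟩
      refine ⟨Multiplicative (Fin 2 → ZMod N), inferInstance, inferInstance,
        AddMonoidHom.toMultiplicative ((Int.castAddHom (ZMod N)).compLeft (Fin 2)), fun h => ?_⟩
      have h' : ∀ j, ((Multiplicative.toAdd a j : ℤ) : ZMod N) = 0 := fun j => by
        have := congrFun (congrArg Multiplicative.toAdd h) j
        exact this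
      have hd : (N : ℤ) ∣ Multiplicative.toAdd a i :=
        (ZMod.intCast_zmod_eq_zero_iff_dvd _ N).1 (h' i)
      have hlt : (Multiplicative.toAdd a i).natAbs < (N : ℤ).natAbs := by
        rw [Int.natAbs_natCast]; exact Nat.lt_succ_self _
      exact hi (Int.eq_zero_of_dvd_of_natAbs_lt_natAbs hd hlt)
    have hc : cc (θ γ) = cc γ :=
      Literature.GroupTheory.map_eq_of_eta_conj_of_separating hsep θ n hn cc γ
    rw [key, key, hc]
  have hB : ∀ p : Path.Homotopic.Quotient x'.val x'.val,
      classDisplacement Φ (p.map Hc) =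
        realRep Φ Φ (topRep (Φ₁ := Φ) (Φ := Φ) hHc) (classDisplacement Φ p) := by
    intro p
    induction p using Path.Homotopic.Quotient.ind with | mk l =>
    rw [← Path.Homotopic.Quotient.mk_map, classDisplacement_mk, classDisplacement_mk]
    exact pathDisplacement_map_affine Φ hHc _ hHaff l
  have hC : ∀ γ : FundamentalGroup _ x',
      realRep Φ Φ (topRep (Φ₁ := Φ) (Φ := Φ) hHc) (DX γ) = DX γ := by
    intro γ
    obtain ⟨q, hq⟩ := Path.Homotopic.Quotient.mk_surjective (FundamentalGroup.toPath (θ γ))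
    have h1 : classDisplacement Φ (((FundamentalGroup.toPath (θ γ)).map σ').map incl) =
        realRep Φ Φ (topRep (Φ₁ := Φ) (Φ := Φ) hHc) (DX γ) := by
      rw [← hA γ]
      change _ = realRep Φ Φ _ (classDisplacement Φ ((FundamentalGroup.toPath (θ γ)).map incl))
      rw [← hB, ← hq, ← Path.Homotopic.Quotient.mk_map, ← Path.Homotopic.Quotient.mk_map,
        ← Path.Homotopic.Quotient.mk_map, ← Path.Homotopic.Quotient.mk_map, classDisplacement_mk,
        classDisplacement_mk]
      exact pathDisplacement_congr Φ _ _ (fun t => (hHσ (q t)).symm)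
    obtain ⟨g, hg⟩ := Path.Homotopic.Quotient.mk_surjective (FundamentalGroup.toPath γ)
    have h2 : classDisplacement Φ (((Path.Homotopic.Quotient.mk δ).symm.trans
        ((FundamentalGroup.toPath γ).trans (Path.Homotopic.Quotient.mk δ))).map incl) = DX γ := by
      change _ = classDisplacement Φ ((FundamentalGroup.toPath γ).map incl)
      rw [← hg, ← Path.Homotopic.Quotient.mk_symm, ← Path.Homotopic.Quotient.mk_trans,
        ← Path.Homotopic.Quotient.mk_trans, ← Path.Homotopic.Quotient.mk_map,
        ← Path.Homotopic.Quotient.mk_map, classDisplacement_mk, classDisplacement_mk,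
        Path.map_trans, Path.map_trans, ← Path.map_symm, pathDisplacement_trans, pathDisplacement_trans,
        pathDisplacement_symm]
      abel
    have h := congrArg (fun p => classDisplacement Φ (Path.Homotopic.Quotient.map p incl)) (hθ γ)
    change classDisplacement Φ (((FundamentalGroup.toPath (θ γ)).map σ').map incl) =
      classDisplacement Φ (((Path.Homotopic.Quotient.mk δ).symm.trans
        ((FundamentalGroup.toPath γ).trans (Path.Homotopic.Quotient.mk δ))).map incl) at h
    rw [h1, h2] at h
    exact h
  have hM1 : topRep (Φ₁ := Φ) (Φ := Φ) hHc = 1 := by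
    refine latticeVec_single_injective' Φ fun i => ?_
    obtain ⟨γ, hγ⟩ := hx' i
    have h := hC (FundamentalGroup.fromPath (Path.Homotopic.Quotient.mk γ))
    have hD : DX (FundamentalGroup.fromPath (Path.Homotopic.Quotient.mk γ)) =
        latticeVec Φ (Pi.single i 1) := by
      change classDisplacement Φ (Path.Homotopic.Quotient.map (Path.Homotopic.Quotient.mk γ) incl) = _
      rw [← Path.Homotopic.Quotient.mk_map, classDisplacement_mk]
      exact hγ
    rw [hD, realRep_latticeVec] at h
    exact h
  have hHt : ∀ y : ComplexTorus Φ, H y = y + H 0 := fun y => by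
    rw [hHaff y, hM1, mapMatrix_one]
  have hσc : ∀ x, (σ.hom.toFun x).1 = x.1 + H 0 := fun x => by rw [← hHσ x, hHt]
  have hcS : ∀ s ∈ S, s + H 0 ∈ S := fun s hs => by rw [← hHt s]; exact hHS s hs
  have hdc : hS.toFinset.card • H 0 = 0 := by
    have himg : hS.toFinset.image (· + H 0) = hS.toFinset := by
      apply Finset.eq_of_subset_of_card_le
      · intro y hy
        obtain ⟨s, hs, rfl⟩ := Finset.mem_image.1 hy
        exact hS.mem_toFinset.2 (hcS s (hS.mem_toFinset.1 hs))
      · rw [Finset.card_image_of_injective _ (add_left_injective (H 0))]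
    have h1 : ∑ y ∈ hS.toFinset.image (· + H 0), y = ∑ s ∈ hS.toFinset, (s + H 0) :=
      Finset.sum_image fun x _ y _ h => add_left_injective (H 0) h
    rw [himg, Finset.sum_add_distrib, Finset.sum_const] at h1
    exact (add_eq_left.1 h1.symm)
  have hdpos : 0 < hS.toFinset.card := Finset.card_pos.2 ⟨s₀, hS.mem_toFinset.2 hs₀⟩
  let σit : ℕ → C((ofOpens (M := ComplexTorus Φ) ⟨Sᶜ, hS.isClosed.isOpen_compl⟩
      (isConnected_complexTorus_compl_finite Φ hS hne)).carrier, _) := fun k =>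
    Nat.rec (motive := fun _ => C(_, _)) (ContinuousMap.id _) (fun _ g => σ'.comp g) k
  have hσit : ∀ (k : ℕ) x, (σit k x).1 = x.1 + k • H 0 := by
    intro k
    induction k with
    | zero => intro x; change x.1 = x.1 + 0 • H 0; rw [zero_nsmul, add_zero]
    | succ k ih =>
      intro x
      change (σ.hom.toFun (σit k x)).1 = _
      rw [hσc, ih, succ_nsmul, add_assoc]
  have hfix : σit hS.toFinset.card = ContinuousMap.id _ := by
    ext x
    exact Subtype.ext (by rw [hσit, hdc, add_zero]; rfl)
  let L : ∀ m : ℕ, Path x' (σit (m + 1) x') := fun m =>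
    Nat.rec (motive := fun m => Path x' (σit (m + 1) x')) δ
      (fun _ Lm => δ.trans (Lm.map σ'.continuous)) m
  have IT : ∀ (m : ℕ) (γ : FundamentalGroup _ x'),
      Path.Homotopic.Quotient.map (FundamentalGroup.toPath (θ^[m + 1] γ)) (σit (m + 1)) =
        (Path.Homotopic.Quotient.mk (L m)).symm.trans
          ((FundamentalGroup.toPath γ).trans (Path.Homotopic.Quotient.mk (L m))) := by
    intro m
    induction m with
    | zero => intro γ; exact hθ γ
    | succ m ih =>
      intro γ
      exact twist_comp (σit (m + 1)) σ' (L m) δ (θ^[m + 1]) θ ih hθ γ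
  obtain ⟨d', hd'⟩ : ∃ d', hS.toFinset.card = d' + 1 := ⟨hS.toFinset.card - 1, by omega⟩
  have hFid : σit (d' + 1) = ContinuousMap.id _ := by rw [← hd']; exact hfix
  set ℓ₀ : Path x' x' := (L d').cast rfl (by rw [hFid]; rfl) with hℓ₀
  have hconj : ∀ γ : FundamentalGroup _ x',
      θ^[d' + 1] γ = FundamentalGroup.fromPath (Path.Homotopic.Quotient.mk ℓ₀) * γ *
        (FundamentalGroup.fromPath (Path.Homotopic.Quotient.mk ℓ₀))⁻¹ := by
    intro γ
    have h := untwist_id (σit (d' + 1)) hFid (L d') (FundamentalGroup.toPath (θ^[d' + 1] γ))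
      (FundamentalGroup.toPath γ) (IT d' γ)
    rw [FundamentalGroup.mul_def, FundamentalGroup.mul_def, FundamentalGroup.inv_def]
    exact h
  have hpow : ∀ (k : ℕ) γ, toCompletion _ (θ^[k] γ) = (n ^ k)⁻¹ * toCompletion _ γ * n ^ k := by
    intro k
    induction k with
    | zero => intro γ; rw [pow_zero, inv_one, one_mul, mul_one]; rfl
    | succ k ih =>
      intro γ
      rw [Function.iterate_succ_apply, ih, hn, pow_succ']
      group
  have hZ : Subgroup.center (profiniteCompletion (FundamentalGroup _ x')) = ⊥ := by
    obtain ⟨e⟩ := nonempty_mulEquiv_freeGroup_complexTorus_compl_finite Φ hS hne x'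
    have hslim := Literature.GroupTheory.isSlimGroup_profiniteCompletion_of_mulEquiv_freeGroup e
      (by have := (Set.ncard_pos hS).2 hne; omega)
    have h := hslim.centralizer_eq_bot ⊤ isOpen_univ
    rwa [Subgroup.coe_top, Subgroup.centralizer_univ] at h
  set Lc : FundamentalGroup _ x' := FundamentalGroup.fromPath (Path.Homotopic.Quotient.mk ℓ₀)
    with hLc
  have hcomm : ∀ γ : FundamentalGroup _ x',
      (n ^ (d' + 1) * toCompletion _ Lc) * toCompletion _ γ =
        toCompletion _ γ * (n ^ (d' + 1) * toCompletion _ Lc) := by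
    intro γ
    have h := hpow (d' + 1) γ
    rw [hconj γ, map_mul, map_mul, map_inv] at h
    have h2 : n ^ (d' + 1) * (toCompletion _ Lc * toCompletion _ γ * (toCompletion _ Lc)⁻¹) *
        toCompletion _ Lc = n ^ (d' + 1) * ((n ^ (d' + 1))⁻¹ * toCompletion _ γ * n ^ (d' + 1)) *
        toCompletion _ Lc := by rw [h]
    rw [show n ^ (d' + 1) * (toCompletion _ Lc * toCompletion _ γ * (toCompletion _ Lc)⁻¹) *
        toCompletion _ Lc = n ^ (d' + 1) * toCompletion _ Lc * toCompletion _ γ by group,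
      show n ^ (d' + 1) * ((n ^ (d' + 1))⁻¹ * toCompletion _ γ * n ^ (d' + 1)) * toCompletion _ Lc =
        toCompletion _ γ * (n ^ (d' + 1) * toCompletion _ Lc) by group] at h2
    exact h2
  have hcentral : n ^ (d' + 1) * toCompletion _ Lc = 1 := by
    have hmem : n ^ (d' + 1) * toCompletion _ Lc ∈
        Subgroup.center (profiniteCompletion (FundamentalGroup _ x')) := by
      rw [Subgroup.mem_center_iff]
      intro z
      refine (ProfiniteGrp.ProfiniteCompletion.denseRange (GrpCat.of (FundamentalGroup _ x'))
        ).induction_on z ?_ (fun γ => (hcomm γ).symm)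
      exact isClosed_eq (continuous_id.mul continuous_const) (continuous_const.mul continuous_id)
    rw [hZ] at hmem
    exact hmem
  haveI : NeZero (d' + 1) := ⟨Nat.succ_ne_zero _⟩
  let A : Type := Multiplicative (Fin 2 → ZMod (d' + 1))
  have hA1 : ∀ a : A, a ^ (d' + 1) = 1 := fun a => by
    apply Multiplicative.toAdd.injective
    rw [toAdd_pow, toAdd_one]
    funext j
    simp only [Pi.smul_apply, Pi.zero_apply, nsmul_eq_mul, ZMod.natCast_self, zero_mul]
  let q : FundamentalGroup _ x' →* A :=
    (AddMonoidHom.toMultiplicative ((Int.castAddHom (ZMod (d' + 1))).compLeft (Fin 2))).comp cc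
  letI : TopologicalSpace A := ⊥
  haveI : DiscreteTopology A := ⟨rfl⟩
  haveI : IsTopologicalGroup A :=
    { continuous_mul := continuous_of_discreteTopology
      continuous_inv := continuous_of_discreteTopology }
  let P : ProfiniteGrp.{0} := ProfiniteGrp.of A
  let qhat := ProfiniteGrp.ProfiniteCompletion.lift (G := GrpCat.of (FundamentalGroup _ x'))
    (P := P) (GrpCat.ofHom q)
  have hq : ∀ g : FundamentalGroup _ x', qhat.hom (toCompletion _ g) = q g := fun g => by
    have h := ProfiniteGrp.ProfiniteCompletion.lift_eta (G := GrpCat.of (FundamentalGroup _ x'))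
      (P := P) (GrpCat.ofHom q)
    exact congrArg (fun f => (f : FundamentalGroup _ x' →* _) g) (congrArg GrpCat.Hom.hom h)
  have hqL : q Lc = 1 := by
    have h1 : toCompletion _ Lc = (n ^ (d' + 1))⁻¹ := eq_inv_of_mul_eq_one_right hcentral
    rw [← hq, h1, map_inv]
    have h2 : qhat.hom (n ^ (d' + 1)) = 1 := by
      rw [map_pow]
      exact hA1 _
    rw [h2, inv_one]
  have hDσ : ∀ {a b} (p : Path a b), pathDisplacement Φ ((p.map σ'.continuous).map
      continuous_subtype_val) = pathDisplacement Φ (p.map continuous_subtype_val) := by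
    intro a b p
    have hct : Continuous fun y : ComplexTorus Φ => y + H 0 := continuous_id.add continuous_const
    rw [← pathDisplacement_map_add_right Φ (p.map continuous_subtype_val) (H 0) hct]
    exact pathDisplacement_congr Φ _ _ (fun t => hσc (p t))
  have hDL : ∀ m : ℕ, pathDisplacement Φ ((L m).map continuous_subtype_val) =
      (m + 1) • pathDisplacement Φ (δ.map continuous_subtype_val) := by
    intro m
    induction m with
    | zero =>
      rw [show (0 + 1) • pathDisplacement Φ (δ.map continuous_subtype_val) =
        pathDisplacement Φ (δ.map continuous_subtype_val) by rw [zero_add, one_nsmul]]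
      exact pathDisplacement_congr Φ _ _ (fun t => rfl)
    | succ m ih =>
      change pathDisplacement Φ ((δ.trans ((L m).map σ'.continuous)).map continuous_subtype_val) = _
      rw [Path.map_trans, pathDisplacement_trans, hDσ, ih]
      simp only [succ_nsmul']
  have hDℓ : pathDisplacement Φ (ℓ₀.map continuous_subtype_val) =
      (d' + 1) • pathDisplacement Φ (δ.map continuous_subtype_val) := by
    rw [← hDL d']
    exact pathDisplacement_congr Φ _ _ (fun t => rfl)
  have hDcover : ∀ {a b : ComplexTorus Φ} (γ : Path a b),
      cover Φ (pathDisplacement Φ γ) = b - a := by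
    intro a b γ
    obtain ⟨Γ, hΓ, -⟩ := exists_pathLift Φ γ (e := Φ (lift Φ a)) (by rw [cover_apply_apply, proj_lift])
    rw [pathDisplacement_eq_sub_of_lift Φ γ Γ.continuous hΓ, cover_sub, hΓ 1, hΓ 0, γ.source,
      γ.target]
  have hcov_δ : cover Φ (pathDisplacement Φ (δ.map continuous_subtype_val)) = H 0 := by
    rw [hDcover, hσc, add_sub_cancel_left]
  have hmodd : ∀ j, ((Multiplicative.toAdd (cc Lc) j : ℤ) : ZMod (d' + 1)) = 0 := fun j => by
    have := congrFun (congrArg Multiplicative.toAdd hqL) j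
    exact this
  have hc0 : H 0 = 0 := by
    choose m hm using fun j => (ZMod.intCast_zmod_eq_zero_iff_dvd _ (d' + 1)).1 (hmodd j)
    have hL : DX Lc = latticeVec Φ (Multiplicative.toAdd (cc Lc)) := key Lc
    have hL' : DX Lc = pathDisplacement Φ (ℓ₀.map continuous_subtype_val) := by
      change classDisplacement Φ (Path.Homotopic.Quotient.map (Path.Homotopic.Quotient.mk ℓ₀) incl) = _
      rw [← Path.Homotopic.Quotient.mk_map, classDisplacement_mk]
      exact pathDisplacement_congr Φ _ _ (fun t => rfl)
    have hvec : Multiplicative.toAdd (cc Lc) = fun j => ((d' + 1 : ℕ) : ℤ) * m j := funext hm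
    have heq : (d' + 1) • pathDisplacement Φ (δ.map continuous_subtype_val) =
        (d' + 1) • latticeVec Φ m := by
      rw [← hDℓ, ← hL', hL, hvec, latticeVec, latticeVec, ← map_nsmul]
      congr 1
      funext j
      simp
    have hδΛ : pathDisplacement Φ (δ.map continuous_subtype_val) = latticeVec Φ m :=
      smul_right_injective ℂ (Nat.succ_ne_zero d') heq
    rw [← hcov_δ, hδΛ]
    exact (cover_eq_zero_iff Φ _).2 ⟨m, rfl⟩
  apply hom_ext
  funext x
  apply Subtype.ext
  rw [hσc x, hc0, add_zero]
  rfl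

/-- ★★ **[AbsTopIII] Prop. 4.2 (i) at EVERY elliptic curve minus a non-empty finite set,
UNCONDITIONALLY**: the full subcategory of `HolRS` of objects mapping (holomorphically, finite étale)
to `E ∖ S` (`E = ℂ/Φ(ℤ²)`, `S` finite non-empty; the curves of type `(1, r)`, `r = |S|`, e.g. IUT's
`X̲_v` of type `(1, ℓ)`) — print's «objects of `EA` that map to `X`» — is ID-RIGID.  Inputs: the
slice is id-rigid because `π̂₁(E ∖ S)` is free profinite of rank `|S| + 1 ≥ 2`, hence slim
(`TorusMinusFinite.nonempty_mulEquiv_freeGroup_compl_finite`), and (OUT) holds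
(`torusMinusFinite_outer`); neither (H1) nor the finiteness residuals `hfin`/`hN` of the uniformisation
route are needed. [cite: MochizukiAbsTopIII2015, Proposition 4.2 (i) p.106] -/
theorem isIdRigid_mapsTo_complexTorus_compl_finite (hS : S.Finite) (hne : S.Nonempty) :
    IsIdRigid (ObjectProperty.FullSubcategory fun Y : HolRS =>
      Nonempty (Y ⟶ ofOpens (M := ComplexTorus Φ) ⟨Sᶜ, hS.isClosed.isOpen_compl⟩
        (isConnected_complexTorus_compl_finite Φ hS hne))) := by
  obtain ⟨x'', hx''⟩ := exists_basepoint_basis_loops_compl_finite Φ hS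
  let x' : (ofOpens (M := ComplexTorus Φ) ⟨Sᶜ, hS.isClosed.isOpen_compl⟩
      (isConnected_complexTorus_compl_finite Φ hS hne)).carrier := x''
  have hx' : ∀ i : Fin 2, ∃ γ : Path x' x',
      pathDisplacement Φ (γ.map continuous_subtype_val) = latticeVec Φ (Pi.single i 1) := hx''
  obtain ⟨e⟩ := nonempty_mulEquiv_freeGroup_complexTorus_compl_finite Φ hS hne x'
  exact (ofOpens (M := ComplexTorus Φ) ⟨Sᶜ, hS.isClosed.isOpen_compl⟩
      (isConnected_complexTorus_compl_finite Φ hS hne)).isIdRigid_mapsTo_of_isSlimGroup_of_outer x'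
    (Literature.GroupTheory.isSlimGroup_profiniteCompletion_of_mulEquiv_freeGroup e
      (by have := (Set.ncard_pos hS).2 hne; omega))
    (fun σ δ θ hθ hn => torusMinusFinite_outer Φ hS hne x' hx' σ δ θ hθ hn)

end Outer

end HolRS

end Literature.AnabelianGeometry.AbsoluteAnabelian

end
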